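import Literature.Analysis.FluidPDE.BeltramiFlows

/-!
# Host preparation, I: the helical shear wave

Cell `ns-blowup`, seat `ns-blowup-ecbridge-3` (g0); GROUP C «BRIDGE SUPPORT» of the route
`PalasekTowerBreakdown` (crux `EpisodeBaseG`, item stmt-NavierStokesRegularity-19179, BC3 stub
`host_preparation` = the tree Prop `RungG 0` of `PalasekTowerRegisterGlobalTail.lean`). LABEL: E–C
typing (KERNEL construction). WHAT THIS IS NOT: not Navier–Stokes evidence — elementary vector
calculus of an explicit smooth field on `ℝ³`; nothing here concerns regularity or blow-up.

The level-`0` host of the register is built (in the companion files) from two explicit pieces; this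
file supplies the oscillatory profile: the HELICAL SHEAR WAVE `wave λ x = (sin λx₂, cos λx₂, 0)` — a
circularly polarised strong Beltrami field (`curl (wave λ) = λ • wave λ`, Majda–Bertozzi §2.3.2),
of unit speed (`‖wave λ x‖ = 1`) and strain `‖D(wave λ)(x)‖ ≥ |λ|` — its Jacobian `waveD`, the
Jacobian's derivative `waveDD`, and UNIFORM BOUNDS on `wave`, `D wave`, `D² wave`
(`exists_bound_iteratedFDeriv_wave`). The cut-off packet `curl (χ • wave λ)` built on it is in
`PalasekTowerHostPacket.lean`; quantitative cut-off bounds in `PalasekTowerHostCutoff.lean`.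

References: A. J. Majda, A. L. Bertozzi, *Vorticity and Incompressible Flow* (CUP 2002), §2.3.2
(strong Beltrami fields; the tree file `Literature/Analysis/FluidPDE/BeltramiFlows.lean`)
[cite: MajdaBertozziCUP2002, §2.3.2]; S. Palasek, arXiv:2605.13827 §4 (the open Step 2 whose
register this serves) [cite: Palasek2026ElementaryModel, §4].
-/

noncomputable section

namespace Summit.NavierStokesRegularity.FluidComputer.PalasekTowerClayBridge.Host

open Real Set Function Filter Topology InnerProductSpace
open scoped RealInnerProductSpace ContDiff Laplacian Topology
open Literature.Analysis.FluidPDE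

/-- Local notation for physical space `ℝ³ = EuclideanSpace ℝ (Fin 3)`. -/
local notation "ℝ³" => EuclideanSpace ℝ (Fin 3)

/-- Local notation for the standard basis vectors. -/
local notation "𝐞" j => EuclideanSpace.single (j : Fin 3) (1 : ℝ)

/-! ## §1 The helical shear wave -/

/-- **The helical shear wave** `wave λ x = (sin λx₂, cos λx₂, 0)`: a circularly polarised strong
Beltrami field (`curl = λ •`), unit speed everywhere. [cite: MajdaBertozziCUP2002, §2.3.2] -/
def wave (lam : ℝ) (x : ℝ³) : ℝ³ := !₂[Real.sin (lam * x 2), Real.cos (lam * x 2), 0]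

/-- First component. [folklore] -/
@[simp] theorem wave_apply_zero (lam : ℝ) (x : ℝ³) : wave lam x 0 = Real.sin (lam * x 2) := by
  simp [wave]

/-- Second component. [folklore] -/
@[simp] theorem wave_apply_one (lam : ℝ) (x : ℝ³) : wave lam x 1 = Real.cos (lam * x 2) := by
  simp [wave]

/-- Third component. [folklore] -/
@[simp] theorem wave_apply_two (lam : ℝ) (x : ℝ³) : wave lam x 2 = 0 := by
  simp [wave]

/-- The wave as a combination of the standard basis vectors. [folklore] -/
theorem wave_eq (lam : ℝ) (x : ℝ³) :
    wave lam x = Real.sin (lam * x 2) • (𝐞 0) + Real.cos (lam * x 2) • (𝐞 1) := by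
  ext i
  fin_cases i <;> simp

/-- **Unit speed**: `‖wave λ x‖ = 1`. [folklore] -/
theorem norm_wave (lam : ℝ) (x : ℝ³) : ‖wave lam x‖ = 1 := by
  rw [EuclideanSpace.norm_eq, Fin.sum_univ_three]
  simp

/-- The coordinate functions are the projections. [folklore] -/
private theorem hasFDerivAt_coord (j : Fin 3) (x : ℝ³) :
    HasFDerivAt (fun y : ℝ³ => y j) (EuclideanSpace.proj j : ℝ³ →L[ℝ] ℝ) x :=
  (EuclideanSpace.proj j : ℝ³ →L[ℝ] ℝ).hasFDerivAt

/-- The coordinate form `e₂^*`. [folklore] -/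
def P₂ : ℝ³ →L[ℝ] ℝ := EuclideanSpace.proj (2 : Fin 3)

/-- The rank-one operator `h ↦ λ h₂ e₀`. [folklore] -/
def Q₀ (lam : ℝ) : ℝ³ →L[ℝ] ℝ³ := (lam • P₂).smulRight (𝐞 0)

/-- The rank-one operator `h ↦ λ h₂ e₁`. [folklore] -/
def Q₁ (lam : ℝ) : ℝ³ →L[ℝ] ℝ³ := (lam • P₂).smulRight (𝐞 1)

/-- The Jacobian of the wave: `D(wave λ)(x) = cos(λx₂) λe₂^* ⊗ e₀ − sin(λx₂) λe₂^* ⊗ e₁` (in the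
form produced by the chain rule). [folklore] -/
def waveD (lam : ℝ) (x : ℝ³) : ℝ³ →L[ℝ] ℝ³ :=
  (Real.cos (lam * x 2) • (lam • P₂)).smulRight (𝐞 0) +
    ((-Real.sin (lam * x 2)) • (lam • P₂)).smulRight (𝐞 1)

/-- The derivative of the Jacobian: `D²(wave λ)(x) = −λ sin(λx₂) e₂^* ⊗ Q₀ − λ cos(λx₂) e₂^* ⊗ Q₁`
(in the form produced by the chain rule). [folklore] -/
def waveDD (lam : ℝ) (x : ℝ³) : ℝ³ →L[ℝ] (ℝ³ →L[ℝ] ℝ³) :=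
  ((-Real.sin (lam * x 2)) • (lam • P₂)).smulRight (Q₀ lam) +
    (-(Real.cos (lam * x 2) • (lam • P₂))).smulRight (Q₁ lam)

/-- `λ x₂` has derivative `λ e₂^*`. [folklore] -/
private theorem hasFDerivAt_phase (lam : ℝ) (x : ℝ³) :
    HasFDerivAt (fun y : ℝ³ => lam * y 2) (lam • P₂) x :=
  (hasFDerivAt_coord 2 x).const_mul lam

/-- **The wave is differentiable with Jacobian `waveD`.** [folklore] -/
theorem hasFDerivAt_wave (lam : ℝ) (x : ℝ³) : HasFDerivAt (wave lam) (waveD lam x) x := by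
  have e : wave lam = fun y => Real.sin (lam * y 2) • (𝐞 0) + Real.cos (lam * y 2) • (𝐞 1) :=
    funext (wave_eq lam)
  rw [e]
  exact ((hasFDerivAt_phase lam x).sin.smul_const (𝐞 0)).add
    ((hasFDerivAt_phase lam x).cos.smul_const (𝐞 1))

/-- The Jacobian of the wave. [folklore] -/
theorem fderiv_wave (lam : ℝ) (x : ℝ³) : fderiv ℝ (wave lam) x = waveD lam x :=
  (hasFDerivAt_wave lam x).fderiv

/-- The Jacobian of the wave, as a function. [folklore] -/
theorem fderiv_wave_eq (lam : ℝ) : fderiv ℝ (wave lam) = waveD lam :=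
  funext (fderiv_wave lam)

/-- The wave is differentiable. [folklore] -/
theorem differentiable_wave (lam : ℝ) : Differentiable ℝ (wave lam) := fun x =>
  (hasFDerivAt_wave lam x).differentiableAt

/-- **The wave is smooth.** [folklore] -/
theorem contDiff_wave (lam : ℝ) {n : WithTop ℕ∞} : ContDiff ℝ n (wave lam) := by
  have hc : ∀ j : Fin 3, ContDiff ℝ n (fun y : ℝ³ => y j) := fun j =>
    (EuclideanSpace.proj j : ℝ³ →L[ℝ] ℝ).contDiff
  have e : wave lam = fun y => Real.sin (lam * y 2) • (𝐞 0) + Real.cos (lam * y 2) • (𝐞 1) :=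
    funext (wave_eq lam)
  rw [e]
  exact ((contDiff_const.mul (hc 2)).sin.smul contDiff_const).add
    ((contDiff_const.mul (hc 2)).cos.smul contDiff_const)

/-- `(c • ℓ) ⊗ v = c • (ℓ ⊗ v)` for rank-one operators. [folklore] -/
private theorem smulRight_smul (c : ℝ) (ℓ : ℝ³ →L[ℝ] ℝ) (v : ℝ³) :
    (c • ℓ).smulRight v = c • ℓ.smulRight v := by
  ext h
  simp [mul_smul]

/-- The Jacobian as a combination of the constant rank-one operators `Q₀`, `Q₁`. [folklore] -/
theorem waveD_eq (lam : ℝ) (x : ℝ³) :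
    waveD lam x = Real.cos (lam * x 2) • Q₀ lam + (-Real.sin (lam * x 2)) • Q₁ lam := by
  simp only [waveD, Q₀, Q₁, smulRight_smul]

/-- **The Jacobian has derivative `waveDD`.** [folklore] -/
theorem hasFDerivAt_waveD (lam : ℝ) (x : ℝ³) : HasFDerivAt (waveD lam) (waveDD lam x) x := by
  have e : waveD lam = fun y => Real.cos (lam * y 2) • Q₀ lam + (-Real.sin (lam * y 2)) • Q₁ lam :=
    funext (waveD_eq lam)
  rw [e]
  exact ((hasFDerivAt_phase lam x).cos.smul_const (Q₀ lam)).add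
    ((hasFDerivAt_phase lam x).sin.neg.smul_const (Q₁ lam))

/-- The second derivative of the wave. [folklore] -/
theorem fderiv_waveD (lam : ℝ) (x : ℝ³) : fderiv ℝ (waveD lam) x = waveDD lam x :=
  (hasFDerivAt_waveD lam x).fderiv

/-- Action of the Jacobian: `D(wave λ)(x) h = λ h₂ (cos λx₂, −sin λx₂, 0)`. [folklore] -/
theorem waveD_apply (lam : ℝ) (x h : ℝ³) :
    waveD lam x h = (lam * h 2) • !₂[Real.cos (lam * x 2), -Real.sin (lam * x 2), 0] := by
  ext i
  fin_cases i <;> simp [waveD, P₂] <;> ring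

/-- **Strong Beltrami**: `curl (wave λ) x = λ • wave λ x`. [cite: MajdaBertozziCUP2002, §2.3.2] -/
theorem curl_wave (lam : ℝ) (x : ℝ³) : curl (wave lam) x = lam • wave lam x := by
  rw [curl_eq_curlCLM, fderiv_wave, curlCLM_apply]
  ext i
  fin_cases i <;> simp [waveD_apply]

/-- The wave is a Beltrami field with the constant coefficient `λ`. [cite: MajdaBertozziCUP2002, §2.3.2] -/
theorem isBeltrami_wave (lam : ℝ) : IsBeltrami (wave lam) fun _ => lam := fun x => curl_wave lam x

/-- The unit vector in the direction of the Jacobian's image: `‖(cos θ, −sin θ, 0)‖ = 1`. [folklore] -/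
private theorem norm_rot (θ : ℝ) : ‖(!₂[Real.cos θ, -Real.sin θ, 0] : ℝ³)‖ = 1 := by
  rw [EuclideanSpace.norm_eq, Fin.sum_univ_three]
  simp

/-- `‖D(wave λ)(x) h‖ = |λ| |h₂|`. [folklore] -/
theorem norm_waveD_apply (lam : ℝ) (x h : ℝ³) : ‖waveD lam x h‖ = |lam| * |h 2| := by
  rw [waveD_apply, norm_smul, norm_rot, mul_one, Real.norm_eq_abs, abs_mul]

/-- **The strain of the wave**: `|λ| ≤ ‖D(wave λ)(x)‖` (test against `e₂`). [folklore] -/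
theorem le_norm_fderiv_wave (lam : ℝ) (x : ℝ³) : |lam| ≤ ‖fderiv ℝ (wave lam) x‖ := by
  rw [fderiv_wave]
  have h := (waveD lam x).le_opNorm (𝐞 2)
  rw [norm_waveD_apply] at h
  simpa using h

/-- `‖D(wave λ)(x)‖ ≤ |λ|`. [folklore] -/
theorem norm_fderiv_wave_le (lam : ℝ) (x : ℝ³) : ‖fderiv ℝ (wave lam) x‖ ≤ |lam| := by
  rw [fderiv_wave]
  refine ContinuousLinearMap.opNorm_le_bound _ (abs_nonneg lam) fun h => ?_
  rw [norm_waveD_apply]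
  gcongr
  simpa using PiLp.norm_apply_le h 2

/-- `‖m ⊗ Q‖ ≤ ‖ℓ‖ ‖Q‖` whenever `‖m‖ ≤ ‖ℓ‖`. [folklore] -/
private theorem norm_smulRight_le_of_norm_le {m ℓ : ℝ³ →L[ℝ] ℝ} (hm : ‖m‖ ≤ ‖ℓ‖)
    (Q : ℝ³ →L[ℝ] ℝ³) : ‖m.smulRight Q‖ ≤ ‖ℓ‖ * ‖Q‖ := by
  rw [ContinuousLinearMap.norm_smulRight_apply]
  exact mul_le_mul_of_nonneg_right hm (norm_nonneg _)

/-- `‖c • ℓ‖ ≤ ‖ℓ‖` for `|c| ≤ 1`. [folklore] -/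
private theorem norm_smul_le_of_abs_le_one {c : ℝ} (hc : |c| ≤ 1) (ℓ : ℝ³ →L[ℝ] ℝ) :
    ‖c • ℓ‖ ≤ ‖ℓ‖ := by
  rw [norm_smul, Real.norm_eq_abs]
  exact mul_le_of_le_one_left (norm_nonneg _) hc

/-- A uniform bound on the second derivative `waveDD`. [folklore] -/
theorem norm_waveDD_le (lam : ℝ) (x : ℝ³) :
    ‖waveDD lam x‖ ≤ ‖lam • P₂‖ * ‖Q₀ lam‖ + ‖lam • P₂‖ * ‖Q₁ lam‖ := by
  have hA : ‖((-Real.sin (lam * x 2)) • (lam • P₂)).smulRight (Q₀ lam)‖ ≤ ‖lam • P₂‖ * ‖Q₀ lam‖ :=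
    norm_smulRight_le_of_norm_le
      (norm_smul_le_of_abs_le_one (by rw [abs_neg]; exact Real.abs_sin_le_one _) _) _
  have hB : ‖(-(Real.cos (lam * x 2) • (lam • P₂))).smulRight (Q₁ lam)‖ ≤ ‖lam • P₂‖ * ‖Q₁ lam‖ :=
    norm_smulRight_le_of_norm_le
      (by rw [norm_neg]; exact norm_smul_le_of_abs_le_one (Real.abs_cos_le_one _) _) _
  have key := norm_add_le (((-Real.sin (lam * x 2)) • (lam • P₂)).smulRight (Q₀ lam))
    ((-(Real.cos (lam * x 2) • (lam • P₂))).smulRight (Q₁ lam))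
  exact key.trans (add_le_add hA hB)

/-- **Uniform bounds on the wave and its first two derivatives**: some `C` bounds
`‖Dⁱ(wave λ)(x)‖` for `i ≤ 2` and all `x`. [folklore] -/
theorem exists_bound_iteratedFDeriv_wave (lam : ℝ) :
    ∃ C : ℝ, 0 ≤ C ∧ ∀ i, i ≤ 2 → ∀ x : ℝ³, ‖iteratedFDeriv ℝ i (wave lam) x‖ ≤ C := by
  set C₂ : ℝ := ‖lam • P₂‖ * ‖Q₀ lam‖ + ‖lam • P₂‖ * ‖Q₁ lam‖ with hC₂
  refine ⟨1 + |lam| + C₂, by positivity, fun i hi x => ?_⟩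
  have hC₂0 : 0 ≤ C₂ := by positivity
  interval_cases i
  · rw [norm_iteratedFDeriv_zero, norm_wave]
    have := abs_nonneg lam
    linarith
  · rw [norm_iteratedFDeriv_one]
    have := norm_fderiv_wave_le lam x
    linarith
  · rw [← norm_iteratedFDeriv_fderiv, norm_iteratedFDeriv_one, fderiv_wave_eq, fderiv_waveD]
    have := norm_waveDD_le lam x
    have := abs_nonneg lam
    linarith

end Summit.NavierStokesRegularity.FluidComputer.PalasekTowerClayBridge.Host

end
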